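import Mathlib
import Literature.Computability.Complexity.GraphEncodings
import Literature.Computability.Complexity.FoldCatBricks
import Literature.Computability.Complexity.UnaryOffsets
import Literature.Computability.Complexity.UnaryBricks
import Literature.Computability.Complexity.FPStringBricks
import Literature.Computability.Complexity.PlumbingBricks
import Literature.Computability.Complexity.Classes
import Literature.Computability.Complexity.SparseSetsUpwardSeparationNE
import Summits.PneNP.PneNP.Theorems.SymmetryBudgetWindowBarrierRankDict
import Summits.PneNP.PneNP.Theorems.SymmetryBudgetWindowBarrierExtractBricks
import Summits.PneNP.PneNP.Theorems.SymmetryBudgetWindowBarrierExtractBricks2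

/-!
# Twin-isomorphism bricks for stub `stub_twinIsoInP_of_canonicalForm` (line `bijection-gauge-twin-iso`,
crux `SymmetryBudget.WindowBarrier`, item stmt-PneNP-2145)

`FP` string functions, assembled from the tree's brick algebra only (no machine is programmed), that
read off the code `w = ⟨encodeNat m, A⟩` of an `m`-vertex graph (`A` = row-major adjacency bits) the
code of the MARKED TWIN GRAPH of the line `bijection-gauge-twin-iso`. With `g = ⌊log₂ m⌋` free vertices
`n + t` (`t < g`, `n = m - g`; parameters `unM/unG/unN` of `SymmetryBudgetWindowBarrierExtractBricks.lean`):

* `bitOf ⟨w, o⟩ = [A[|o|]]` — one bit of `A` at a unary offset (a window of length `1`);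
* `mkOf w t = A[n + t]` — the MARKER bit of free vertex `t` (its adjacency to the ordered vertex `0`),
  read by `markBit ⟨w, 1ᵗ⟩ = [mkOf w t]`;
* `chiFn b w = encList [encodeNat (chiVal b w t) | t < g]`, `chiVal b w t = [mkOf w t = b]` — the items
  part of the colour list of the colouring "`1` on the free vertices with marker `b`";
* `twinMaskFn w` — the `g²` bits `twinMaskOf w t c = A[(n+t) m + n + c] ∧ [mkOf w t = mkOf w c]`: the adjacency
  string of the free graph with all edges BETWEEN the two marker classes deleted (a double
  `Brick.foldCat` of one-bit pieces);
* `twinCode b w = ⟨⟨encodeNat g, twinMaskFn w⟩, ⟨1ᵍ, chiFn b w⟩⟩` — on a graph code, the code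
  `⟨encodingGraph-code, encodingFinVec-code⟩` of the coloured twin graph (proved in
  `SymmetryBudgetWindowBarrierStubTwinIsoInP.lean`), with `|twinCode b w| ≤ (3 (⌊log₂|w|⌋ + 1))²` on EVERY
  input, whence `can ∘ twinCode b ∈ FP` for every `can ∈ FTIME (N ↦ 2^{c√N})`
  (`CompleteInvariant.comp_mem_FP_of_FTIME_sqrt`).
-/

-- `Summit.PneNP.PneNP.…` duplicates `PneNP` BY DESIGN (single-problem summit).
set_option linter.dupNamespace false

namespace Summit.PneNP.PneNP.Theorems.TwinIso

open Literature.Computability.Complexity Brick Plumb UnaryOffsets CompleteInvariant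
open _root_.Computability Polynomial

/-! ### Single bits of the adjacency string -/

/-- `bitOf ⟨w, o⟩ = [A[|o|]]` (`A = sndF w`, default `0`): the window of length `1` at offset `|o|`. -/
noncomputable def bitOf : List Bool → List Bool := winPiece sndF (fun _ => [true])

/-- `bitOf ∈ FP`. -/
theorem bitOf_mem_FP : bitOf ∈ FP := winPiece_mem_FP sndF_mem_FP (const_mem_FP _)

/-- Value of `bitOf` on every input. -/
theorem bitOf_apply (z : List Bool) : bitOf z = [(sndF (fstF z)).getD (sndF z).length false] := by
  rw [bitOf, winPiece_apply, window_eq_ofFn]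
  show List.ofFn (fun c : Fin 1 => _) = _
  simp

/-- `bitOf` is one-bit. -/
theorem oneBit_bitOf : OneBit bitOf := fun z => ⟨_, bitOf_apply z⟩

/-! ### The marker bits -/

/-- **The marker bit** of free vertex `t` read off `w`: bit `n + t` of `A` (row `0`, column `n + t`). -/
noncomputable def mkOf (w : List Bool) (t : ℕ) : Bool := (sndF w).getD ((unN w).length + t) false

/-- The offset `unN w ++ u` (on `⟨w, u⟩`), of length `n + |u|`. -/
noncomputable def offMark : List Bool → List Bool := appF ∘ fanoutFn (unN ∘ fstF) sndF

/-- `offMark ∈ FP`. -/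
theorem offMark_mem_FP : offMark ∈ FP :=
  comp_mem_FP appF_mem_FP (fanoutFn_mem_FP (comp_mem_FP unN_mem_FP fstF_mem_FP) sndF_mem_FP)

/-- `|offMark z| = |unN (fstF z)| + |sndF z|`. -/
@[simp] theorem length_offMark (z : List Bool) : (offMark z).length = (unN (fstF z)).length + (sndF z).length := by
  simp [offMark]

/-- **`markBit ⟨w, 1ᵗ⟩ = [mkOf w t]`.** -/
noncomputable def markBit : List Bool → List Bool := bitOf ∘ fanoutFn fstF offMark

/-- `markBit ∈ FP`. -/
theorem markBit_mem_FP : markBit ∈ FP := comp_mem_FP bitOf_mem_FP (fanoutFn_mem_FP fstF_mem_FP offMark_mem_FP)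

/-- Value of `markBit` on every input. -/
theorem markBit_apply (z : List Bool) : markBit z = [mkOf (fstF z) (sndF z).length] := by
  simp [markBit, bitOf_apply, mkOf]

/-- The colour of free vertex `t` in the colouring "`1` on marker `b`": `[mkOf w t = b]`. -/
noncomputable def chiVal (b : Bool) (w : List Bool) (t : ℕ) : ℕ := if mkOf w t = b then 1 else 0

/-- `chiVal ≤ 1`. -/
theorem chiVal_le (b : Bool) (w : List Bool) (t : ℕ) : chiVal b w t ≤ 1 := by
  unfold chiVal; split_ifs <;> simp

/-- The colour bit: on `⟨w, 1ᵗ⟩`, `encodeNat (chiVal b w t)` (`[1]` or `ε`). -/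
noncomputable def chiBit (b : Bool) : List Bool → List Bool :=
  iteFn (eqPairFn ∘ fanoutFn markBit (fun _ => [b])) (fun _ => [true]) (fun _ => [])

/-- `chiBit b ∈ FP`. -/
theorem chiBit_mem_FP (b : Bool) : chiBit b ∈ FP :=
  iteFn_mem_FP (comp_mem_FP eqPairFn_mem_FP (fanoutFn_mem_FP markBit_mem_FP (const_mem_FP _)))
    (const_mem_FP _) (const_mem_FP _)

/-- Value of `chiBit` on every input. -/
theorem chiBit_apply (b : Bool) (z : List Bool) : chiBit b z = encodeNat (chiVal b (fstF z) (sndF z).length) := by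
  unfold chiBit chiVal
  have hc : (eqPairFn ∘ fanoutFn markBit (fun _ => [b])) z = [decide (mkOf (fstF z) (sndF z).length = b)] := by
    simp [markBit_apply, eqPairFn_boolPair]
  rw [iteFn_apply hc]
  by_cases h : mkOf (fstF z) (sndF z).length = b
  · have e : encodeNat 1 = [true] := by decide
    simp [h, e]
  · have e : encodeNat 0 = [] := by decide
    simp [h, e]

/-- `|chiBit b z| ≤ 1`. -/
theorem length_chiBit_le (b : Bool) (z : List Bool) : (chiBit b z).length ≤ 1 := by
  rw [chiBit_apply]
  exact (CompleteInvariant.length_encodeNat_le_self _).trans (chiVal_le _ _ _)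

/-- The colour piece: on `⟨w, 1ᵗ⟩`, the frame `⟨encodeNat (chiVal b w t), ε⟩`. -/
noncomputable def chiPiece (b : Bool) : List Bool → List Bool := fanoutFn (chiBit b) (fun _ => [])

/-- `chiPiece b ∈ FP`. -/
theorem chiPiece_mem_FP (b : Bool) : chiPiece b ∈ FP := fanoutFn_mem_FP (chiBit_mem_FP b) (const_mem_FP _)

/-- Value of `chiPiece` on a pair. -/
@[simp] theorem chiPiece_boolPair (b : Bool) (w u : List Bool) :
    chiPiece b (boolPair w u) = boolPair (encodeNat (chiVal b w u.length)) [] := by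
  simp [chiPiece, chiBit_apply]

/-- `|chiPiece b z| ≤ 4`. -/
theorem length_chiPiece_le (b : Bool) (z : List Bool) : (chiPiece b z).length ≤ 4 := by
  have := length_chiBit_le b z
  simp only [chiPiece, fanoutFn_apply, length_boolPair, List.length_nil]
  omega

/-- **The colour list** `chiFn b w = encList [encodeNat (chiVal b w t) | t < g]`. -/
noncomputable def chiFn (b : Bool) : List Bool → List Bool := foldCat 4 X (chiPiece b) ∘ fanoutFn id unG

/-- `chiFn b ∈ FP`. -/
theorem chiFn_mem_FP (b : Bool) : chiFn b ∈ FP :=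
  comp_mem_FP (foldCat_mem_FP _ X (chiPiece_mem_FP b)) (fanoutFn_mem_FP (PolyTimeComputable.id _) unG_mem_FP)

/-- Value of `chiFn` as a concatenation of frames. -/
theorem chiFn_eq_ccat (b : Bool) (w : List Bool) :
    chiFn b w = ccat (fun t => boolPair (encodeNat (chiVal b w t)) []) (unG w).length := by
  have h := foldCat_apply (Q := 4) (p := X) (f := chiPiece b) (x := w) (u := unG w)
    (by simpa using length_unG_le' w) (fun t _ => (length_chiPiece_le b _).trans (by simp))
  simp only [chiFn, Function.comp_apply, fanoutFn_apply, id, h]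
  refine ccat_congr fun t _ => ?_
  rw [chiPiece_boolPair]; simp [ones]

/-- **Value of `chiFn` on every input.** -/
theorem chiFn_apply (b : Bool) (w : List Bool) :
    chiFn b w = encList ((List.range (unG w).length).map fun t => encodeNat (chiVal b w t)) := by
  rw [chiFn_eq_ccat, ccat_frame_eq_encList]

/-- `|chiFn b w| ≤ 4 |unG w|`. -/
theorem length_chiFn_le (b : Bool) (w : List Bool) : (chiFn b w).length ≤ (unG w).length * 4 := by
  rw [chiFn_eq_ccat]
  refine length_ccat_le' _ fun t _ => ?_
  have := (CompleteInvariant.length_encodeNat_le_self (chiVal b w t)).trans (chiVal_le b w t)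
  simp only [length_boolPair, List.length_nil]; omega

/-! ### The masked free block -/

/-- The offset `(n + t) m + n + c` (on the record `⟨⟨w, 1ᵗ⟩, 1ᶜ⟩`): the position of the bit
`(free t, free c)` of `A`. -/
noncomputable def offTC : List Bool → List Bool := appF ∘ fanoutFn (offFree' ∘ fstF) sndF

/-- `offTC ∈ FP`. -/
theorem offTC_mem_FP : offTC ∈ FP :=
  comp_mem_FP appF_mem_FP (fanoutFn_mem_FP (comp_mem_FP offFree'_mem_FP fstF_mem_FP) sndF_mem_FP)

/-- `|offTC ⟨⟨w, u⟩, v⟩| = (|unN w| + |u|) |unM w| + |unN w| + |v|`. -/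
@[simp] theorem length_offTC (w u v : List Bool) : (offTC (boolPair (boolPair w u) v)).length =
    ((unN w).length + u.length) * (unM w).length + (unN w).length + v.length := by
  simp [offTC]

/-- The free bit: on `⟨⟨w, 1ᵗ⟩, 1ᶜ⟩`, `[A[(n + t) m + n + c]]`. -/
noncomputable def freeBit : List Bool → List Bool := bitOf ∘ fanoutFn (fstF ∘ fstF) offTC

/-- `freeBit ∈ FP`. -/
theorem freeBit_mem_FP : freeBit ∈ FP :=
  comp_mem_FP bitOf_mem_FP (fanoutFn_mem_FP (comp_mem_FP fstF_mem_FP fstF_mem_FP) offTC_mem_FP)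

/-- `freeBit` is one-bit. -/
theorem oneBit_freeBit : OneBit freeBit := oneBit_bitOf.comp _

/-- Value of `freeBit` on a record. -/
theorem freeBit_apply (w u v : List Bool) : freeBit (boolPair (boolPair w u) v) =
    [(sndF w).getD (((unN w).length + u.length) * (unM w).length + (unN w).length + v.length) false] := by
  simp [freeBit, bitOf_apply]

/-- **The masked bit** `(t, c)`: the free adjacency bit `A[(n+t) m + n + c]`, kept only inside a marker class. -/
noncomputable def twinMaskOf (w : List Bool) (t c : ℕ) : Bool :=
  (sndF w).getD (((unN w).length + t) * (unM w).length + (unN w).length + c) false && decide (mkOf w t = mkOf w c)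

/-- The mask piece: on `⟨⟨w, 1ᵗ⟩, 1ᶜ⟩`, `[twinMaskOf w t c]`. -/
noncomputable def twinMaskPiece : List Bool → List Bool :=
  andFn freeBit (eqPairFn ∘ fanoutFn (markBit ∘ fstF) (markBit ∘ inner))

/-- `twinMaskPiece ∈ FP`. -/
theorem twinMaskPiece_mem_FP : twinMaskPiece ∈ FP :=
  andFn_mem_FP freeBit_mem_FP (comp_mem_FP eqPairFn_mem_FP
    (fanoutFn_mem_FP (comp_mem_FP markBit_mem_FP fstF_mem_FP) (comp_mem_FP markBit_mem_FP inner_mem_FP)))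

/-- Value of `twinMaskPiece` on a record. -/
theorem twinMaskPiece_apply (w u v : List Bool) :
    twinMaskPiece (boolPair (boolPair w u) v) = [twinMaskOf w u.length v.length] := by
  unfold twinMaskPiece twinMaskOf
  have hc : (eqPairFn ∘ fanoutFn (markBit ∘ fstF) (markBit ∘ inner)) (boolPair (boolPair w u) v) =
      [decide (mkOf w u.length = mkOf w v.length)] := by
    simp [markBit_apply, eqPairFn_boolPair]
  rw [andFn_apply (freeBit_apply w u v) hc]

/-- `|twinMaskPiece z| = 1` on every input. -/
theorem length_twinMaskPiece (z : List Bool) : (twinMaskPiece z).length = 1 := by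
  unfold twinMaskPiece
  obtain ⟨b, hb⟩ := oneBit_freeBit z
  rcases eqPairFn_eq_or (fanoutFn (markBit ∘ fstF) (markBit ∘ inner) z) with h | h
  · rw [andFn_apply hb (show (eqPairFn ∘ _) z = [true] from h)]; rfl
  · rw [andFn_apply hb (show (eqPairFn ∘ _) z = [false] from h)]; rfl

/-- **Row `t` of the mask**: on `⟨w, 1ᵗ⟩`, `[twinMaskOf w t 0, …, twinMaskOf w t (g-1)]`. -/
noncomputable def twinMaskRow : List Bool → List Bool := foldCat 1 X twinMaskPiece ∘ fanoutFn id (unG ∘ fstF)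

/-- `twinMaskRow ∈ FP`. -/
theorem twinMaskRow_mem_FP : twinMaskRow ∈ FP :=
  comp_mem_FP (foldCat_mem_FP 1 X twinMaskPiece_mem_FP)
    (fanoutFn_mem_FP (PolyTimeComputable.id _) (comp_mem_FP unG_mem_FP fstF_mem_FP))

/-- Value of `twinMaskRow` on a pair. -/
theorem twinMaskRow_boolPair (w u : List Bool) :
    twinMaskRow (boolPair w u) = ccat (fun c => [twinMaskOf w u.length c]) (unG w).length := by
  have hlen : (unG w).length ≤ X.eval (boolPair w u).length := by
    have := length_unG_le' w
    simp only [eval_X, length_boolPair]; omega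
  have h := foldCat_apply (Q := 1) (p := X) (f := twinMaskPiece) (x := boolPair w u) (u := unG w) hlen
    (fun t _ => by rw [length_twinMaskPiece]; simp)
  simp only [twinMaskRow, Function.comp_apply, fanoutFn_apply, id, fstF_boolPair, h]
  refine ccat_congr fun c _ => ?_
  rw [twinMaskPiece_apply]; simp [ones]

/-- A concatenation of single bits is a `List.ofFn`. -/
theorem ccat_singleton (f : ℕ → Bool) : ∀ k : ℕ, ccat (fun c => [f c]) k = List.ofFn fun c : Fin k => f c
  | 0 => rfl
  | k + 1 => by rw [ccat_succ, ccat_singleton f k, List.ofFn_succ', List.concat_eq_append]; rfl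

/-- `|twinMaskRow ⟨w, u⟩| = |unG w|`. -/
@[simp] theorem length_twinMaskRow_boolPair (w u : List Bool) : (twinMaskRow (boolPair w u)).length = (unG w).length := by
  rw [twinMaskRow_boolPair, ccat_singleton, List.length_ofFn]

/-- **The masked free block** `twinMaskFn w`: the `g²` bits `twinMaskOf w t c`, row-major. -/
noncomputable def twinMaskFn : List Bool → List Bool := foldCat X X twinMaskRow ∘ fanoutFn id unG

/-- `twinMaskFn ∈ FP`. -/
theorem twinMaskFn_mem_FP : twinMaskFn ∈ FP :=
  comp_mem_FP (foldCat_mem_FP X X twinMaskRow_mem_FP) (fanoutFn_mem_FP (PolyTimeComputable.id _) unG_mem_FP)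

/-- **Value of `twinMaskFn` on every input.** -/
theorem twinMaskFn_apply (w : List Bool) :
    twinMaskFn w = ccat (fun t => ccat (fun c => [twinMaskOf w t c]) (unG w).length) (unG w).length := by
  have h := foldCat_apply (Q := X) (p := X) (f := twinMaskRow) (x := w) (u := unG w)
    (by simpa using length_unG_le' w) (fun t _ => by simpa using length_unG_le' w)
  simp only [twinMaskFn, Function.comp_apply, fanoutFn_apply, id, h]
  refine ccat_congr fun t _ => ?_
  rw [twinMaskRow_boolPair]; simp [ones]

/-- `|twinMaskFn w| ≤ |unG w|²`. -/
theorem length_twinMaskFn_le (w : List Bool) : (twinMaskFn w).length ≤ (unG w).length * (unG w).length := by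
  rw [twinMaskFn_apply]
  exact length_ccat_le' _ fun t _ => by rw [ccat_singleton, List.length_ofFn]

/-! ### The code of the coloured twin graph -/

/-- **The twin code** `twinCode b w = ⟨⟨encodeNat g, twinMaskFn w⟩, ⟨1ᵍ, chiFn b w⟩⟩`. -/
noncomputable def twinCode (b : Bool) : List Bool → List Bool :=
  fanoutFn (fanoutFn (lenBinF ∘ unG) twinMaskFn) (fanoutFn unG (chiFn b))

/-- `twinCode b ∈ FP`. -/
theorem twinCode_mem_FP (b : Bool) : twinCode b ∈ FP :=
  fanoutFn_mem_FP (fanoutFn_mem_FP (comp_mem_FP lenBinF_mem_FP unG_mem_FP) twinMaskFn_mem_FP)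
    (fanoutFn_mem_FP unG_mem_FP (chiFn_mem_FP b))

/-- Value of `twinCode`. -/
theorem twinCode_apply (b : Bool) (w : List Bool) :
    twinCode b w = boolPair (boolPair (encodeNat (unG w).length) (twinMaskFn w)) (boolPair (unG w) (chiFn b w)) := by
  simp [twinCode]

/-- **The intermediate length is poly-logarithmic**: `|twinCode b w| ≤ (3 (⌊log₂ |w|⌋ + 1))²` on every input. -/
theorem length_twinCode_le (b : Bool) (w : List Bool) : (twinCode b w).length ≤ (3 * (Nat.log 2 w.length + 1)) ^ 2 := by
  rw [twinCode_apply, length_boolPair, length_boolPair, length_boolPair]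
  have h1 := length_twinMaskFn_le w
  have h2 := length_chiFn_le b w
  have h3 := CompleteInvariant.length_encodeNat_le_self (unG w).length
  have h4 := length_unG_le w
  set g := (unG w).length
  set L := Nat.log 2 w.length
  have h5 : g * g ≤ L * L := Nat.mul_le_mul h4 h4
  nlinarith

/-- **`can ∘ twinCode b ∈ FP`** for every `can ∈ FTIME (N ↦ 2^{c√N})`: the canoniser runs on a string of
length `≤ (3 (log₂|w| + 1))²`, i.e. for `poly(|w|)` steps (`CompleteInvariant.comp_mem_FP_of_FTIME_sqrt`). -/
theorem can_twinCode_mem_FP (b : Bool) {can : List Bool → List Bool} {c : ℕ}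
    (hcan : can ∈ FTIME fun N => 2 ^ (c * Nat.sqrt N)) : can ∘ twinCode b ∈ FP :=
  comp_mem_FP_of_FTIME_sqrt hcan (twinCode_mem_FP b) 3 fun w =>
    (length_twinCode_le b w).trans (by rw [Nat.mul_add, Nat.mul_one])

end Summit.PneNP.PneNP.Theorems.TwinIso

namespace Summit.PneNP.PneNP.Theorems

open Literature.Computability.Complexity TwinIso

/-- **Registered sub-goal of `stub_twinIsoInP_of_canonicalForm` (`stub_twinIsoInP_twinCode_mem_FP`)**: the
twin code followed by any `2^{O(√N)}`-time canoniser is in `FP` (brick file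
`SymmetryBudgetWindowBarrierTwinIsoBricks`). -/
theorem stub_twinIsoInP_twinCode_mem_FP : ∀ (b : Bool) (c : ℕ) (can : List Bool → List Bool), can ∈ FTIME (fun N => 2 ^ (c * Nat.sqrt N)) → can ∘ twinCode b ∈ FP :=
  fun b _ _ hcan => can_twinCode_mem_FP b hcan

end Summit.PneNP.PneNP.Theorems
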